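import Summits.QuantumFields.GaugeBoot.PeriodicWordReflection
import Summits.QuantumFields.GaugeBoot.TiltedLatticeAxisReversal
import HarnessLib

/-!
# Word holonomies in the reversed presentation of a periodic lattice (gauge-boot, periodic loop equations, supplement; tribunal A31, part 1/2)

HONEST FRAMING (cell `pub-gaugeboot`, page 1 of every file): the venture produces certified bounds
on lattice expectations at stated coupling, gauge group, dimension and torus size; NOT a mass gap,
NOT a continuum limit, NOT a string tension; NOT Yang–Mills-summit-bearing (barriers
`FixedCouplingUltralocality`, `PerturbativeInvisibility`).

Companion of `PeriodicWordSymmetry.lean` (translations) and `PeriodicWordReflection.lean` (axis swaps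
and flips). `TiltedBoxAntiDiagonalRPGeneral.lean` proves anti-diagonal reflection positivity on EVERY
45°-tilted box through the identification `revConfig` of the Wilson theory of `(A, e)` with the one of
the reversed presentation `(A, e')`, `e' = revAxis e j` (`TiltedLatticeAxisReversal.lean`); to USE that
positivity as a Gram block of Wilson-loop variables in a certificate row one needs the action of
`revConfig` — and then of the anti-diagonal reflection `configAntiSwap` — on WORDS (tribunal t1
v2.8/2.9 A31: "nothing covers revConfig (j-steps reversed …)"). This file is the generic half:

* `move_revAxis`, `Word.endpoint_revAxis`, `stepHolonomy_revConfig`, **`wordHolonomy_revConfig`** —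
  the configuration `revConfig e j U`, read with the marked translations `e'`, has along `w` from `x`
  the holonomy of `U` along `w.map (Step.flipAt j)` (the `j`-steps REVERSED letterwise) from the SAME
  base point `x`; hence the loop and pair variables of `μ_{e',β}` are the flipped-word variables of
  `μ_{e,β}` (`integral_trace_wordHolonomy_revAxis`, `integral_trace_mul_trace_wordHolonomy_revAxis`);
* the step relabelling `Step.antiSwap i j` (`+e_i ↦ -e_j`, `+e_j ↦ -e_i`, `-e_i ↦ +e_j`, `-e_j ↦ +e_i`)
  with `Step.flipAt_permute_flipAt : flipAt j ∘ permute (i j) ∘ flipAt j = antiSwap i j` — the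
  letterwise composite met when `revConfig ∘ configSwap ∘ revConfig` is read on words
  (`TiltedBoxAntiDiagonalWords.lean`, part 2/2);
* `isHalfObservable_wordFn` — a function of the holonomy of a word all of whose links are half links
  is a half observable (turns the tree's half-observable RP theorems into Wilson-loop Gram blocks).

Everything is `[folklore]` (bookkeeping; no measure theory beyond the tree's change of variables).

References: K. Osterwalder, E. Seiler, Ann. Phys. 110 (1978) 440, §2 (orientation conventions);
V. Kazakov, Z. Zheng, arXiv:2203.11360 §3.3 (reduction of the loop variables by the symmetry group).
-/

noncomputable section

open MeasureTheory
open scoped ComplexOrder ComplexConjugate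

namespace Summit.QuantumFields.GaugeBoot

namespace Step

variable {d : ℕ}

/-- `flipAt k` is an involution on steps. [folklore] -/
@[simp] theorem flipAt_flipAt (k : Fin d) (s : Step d) : (s.flipAt k).flipAt k = s := by
  cases s with
  | fwd μ => by_cases h : μ = k <;> simp [flipAt, h]
  | bwd μ => by_cases h : μ = k <;> simp [flipAt, h]

/-- The ANTI-DIAGONAL relabelling of steps (the action of `x_i ↦ -x_j, x_j ↦ -x_i` on words):
`+e_i ↦ -e_j`, `+e_j ↦ -e_i`, `-e_i ↦ +e_j`, `-e_j ↦ +e_i`, steps along the other axes unchanged.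
[folklore] -/
def antiSwap (i j : Fin d) : Step d → Step d
  | fwd μ => if μ = i then bwd j else if μ = j then bwd i else fwd μ
  | bwd μ => if μ = i then fwd j else if μ = j then fwd i else bwd μ

/-- `antiSwap` on `+e_i`. [folklore] -/
@[simp] theorem antiSwap_fwd_left (i j : Fin d) : (fwd i : Step d).antiSwap i j = bwd j := by
  simp [antiSwap]

/-- `antiSwap` on `-e_i`. [folklore] -/
@[simp] theorem antiSwap_bwd_left (i j : Fin d) : (bwd i : Step d).antiSwap i j = fwd j := by
  simp [antiSwap]

/-- `antiSwap` on `+e_j`. [folklore] -/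
theorem antiSwap_fwd_right {i j : Fin d} (hij : i ≠ j) : (fwd j : Step d).antiSwap i j = bwd i := by
  simp [antiSwap, hij.symm]

/-- `antiSwap` on `-e_j`. [folklore] -/
theorem antiSwap_bwd_right {i j : Fin d} (hij : i ≠ j) : (bwd j : Step d).antiSwap i j = fwd i := by
  simp [antiSwap, hij.symm]

/-- `antiSwap` on a forward step along another axis. [folklore] -/
theorem antiSwap_fwd_of_ne {i j μ : Fin d} (hi : μ ≠ i) (hj : μ ≠ j) :
    (fwd μ : Step d).antiSwap i j = fwd μ := by
  simp [antiSwap, hi, hj]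

/-- `antiSwap` on a backward step along another axis. [folklore] -/
theorem antiSwap_bwd_of_ne {i j μ : Fin d} (hi : μ ≠ i) (hj : μ ≠ j) :
    (bwd μ : Step d).antiSwap i j = bwd μ := by
  simp [antiSwap, hi, hj]

/-- `antiSwap = flipAt j ∘ permute (i j) ∘ flipAt j` — the letterwise composite met when the
anti-diagonal reflection `revConfig ∘ configSwap ∘ revConfig` is read on words. [folklore] -/
theorem flipAt_permute_flipAt {i j : Fin d} (hij : i ≠ j) (s : Step d) :
    ((s.flipAt j).permute (Equiv.swap i j)).flipAt j = s.antiSwap i j := by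
  cases s with
  | fwd μ =>
    by_cases hi : μ = i
    · subst hi
      rw [flipAt_fwd_of_ne hij, permute_fwd, Equiv.swap_apply_left, flipAt_fwd_self, antiSwap_fwd_left]
    · by_cases hj : μ = j
      · subst hj
        rw [flipAt_fwd_self, permute_bwd, Equiv.swap_apply_right, flipAt_bwd_of_ne hij,
          antiSwap_fwd_right hij]
      · rw [flipAt_fwd_of_ne hj, permute_fwd, Equiv.swap_apply_of_ne_of_ne hi hj, flipAt_fwd_of_ne hj,
          antiSwap_fwd_of_ne hi hj]
  | bwd μ =>
    by_cases hi : μ = i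
    · subst hi
      rw [flipAt_bwd_of_ne hij, permute_bwd, Equiv.swap_apply_left, flipAt_bwd_self, antiSwap_bwd_left]
    · by_cases hj : μ = j
      · subst hj
        rw [flipAt_bwd_self, permute_fwd, Equiv.swap_apply_right, flipAt_fwd_of_ne hij,
          antiSwap_bwd_right hij]
      · rw [flipAt_bwd_of_ne hj, permute_bwd, Equiv.swap_apply_of_ne_of_ne hi hj, flipAt_bwd_of_ne hj,
          antiSwap_bwd_of_ne hi hj]

end Step

namespace TiltedRP

variable {A : Type*} [AddCommGroup A] {d N : ℕ} {G : Type*} [Group G]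

/-! ### Words in the reversed presentation `e' = revAxis e j` -/

/-- A step of the reversed presentation moves as the `j`-flipped step of the original one. [folklore] -/
theorem move_revAxis (e : Fin d → A) (j : Fin d) (x : A) (s : Step d) :
    s.move (revAxis e j) x = (s.flipAt j).move e x := by
  cases s with
  | fwd μ =>
    by_cases h : μ = j
    · subst h; rw [Step.move_fwd, revAxis_self, Step.flipAt_fwd_self, Step.move_bwd, sub_eq_add_neg]
    · rw [Step.move_fwd, revAxis_of_ne _ h, Step.flipAt_fwd_of_ne h, Step.move_fwd]
  | bwd μ =>
    by_cases h : μ = j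
    · subst h; rw [Step.move_bwd, revAxis_self, sub_neg_eq_add, Step.flipAt_bwd_self, Step.move_fwd]
    · rw [Step.move_bwd, revAxis_of_ne _ h, Step.flipAt_bwd_of_ne h, Step.move_bwd]

/-- Endpoints in the reversed presentation are endpoints of the flipped word. [folklore] -/
theorem Word.endpoint_revAxis (e : Fin d → A) (j : Fin d) : ∀ (x : A) (w : Word d),
    Word.endpoint (revAxis e j) x w = Word.endpoint e x (w.map (Step.flipAt j))
  | x, [] => rfl
  | x, s :: w => by
    rw [List.map_cons, Word.endpoint_cons, Word.endpoint_cons, move_revAxis, Word.endpoint_revAxis e j]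

/-- A step holonomy of `revConfig e j U` in the presentation `e'` is the flipped step holonomy of `U`
(the `e'`-link `(x, j)` is the `e`-link `(x - e_j, j)` backwards). [folklore] -/
theorem stepHolonomy_revConfig (e : Fin d → A) (j : Fin d) (U : Config A d G) (x : A) (s : Step d) :
    stepHolonomy (revAxis e j) (revConfig e j U) x s = stepHolonomy e U x (s.flipAt j) := by
  cases s with
  | fwd μ =>
    by_cases h : μ = j
    · subst h; rw [stepHolonomy_fwd, revConfig_self, Step.flipAt_fwd_self, stepHolonomy_bwd]
    · rw [stepHolonomy_fwd, revConfig_other _ _ _ _ h, Step.flipAt_fwd_of_ne h, stepHolonomy_fwd]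
  | bwd μ =>
    by_cases h : μ = j
    · subst h
      rw [stepHolonomy_bwd, revAxis_self, sub_neg_eq_add, revConfig_self, add_sub_cancel_right, inv_inv,
        Step.flipAt_bwd_self, stepHolonomy_fwd]
    · rw [stepHolonomy_bwd, revAxis_of_ne _ h, revConfig_other _ _ _ _ h, Step.flipAt_bwd_of_ne h,
        stepHolonomy_bwd]

/-- **Word holonomies in the reversed presentation**: `hol^{e'}_x(w)(revConfig e j U) =
hol^{e}_x(w^♭)(U)`, `♭` reversing the `j`-steps letterwise; same base point. [folklore] -/
theorem wordHolonomy_revConfig (e : Fin d → A) (j : Fin d) (U : Config A d G) : ∀ (x : A) (w : Word d),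
    wordHolonomy (revAxis e j) (revConfig e j U) x w = wordHolonomy e U x (w.map (Step.flipAt j))
  | x, [] => rfl
  | x, s :: w => by
    rw [List.map_cons, wordHolonomy_cons, wordHolonomy_cons, stepHolonomy_revConfig,
      wordHolonomy_revConfig e j U, move_revAxis]

/-- The same read the other way: `hol^{e}_x(w)(revConfig e' j V) = hol^{e'}_x(w^♭)(V)`. [folklore] -/
theorem wordHolonomy_revConfig' (e : Fin d → A) (j : Fin d) (V : Config A d G) (x : A) (w : Word d) :
    wordHolonomy e (revConfig (revAxis e j) j V) x w =
      wordHolonomy (revAxis e j) V x (w.map (Step.flipAt j)) := by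
  have h := wordHolonomy_revConfig (revAxis e j) j V x w
  rwa [revAxis_revAxis] at h

/-- Flipping twice gives the word back. [folklore] -/
@[simp] theorem map_flipAt_map_flipAt (j : Fin d) (w : Word d) :
    (w.map (Step.flipAt j)).map (Step.flipAt j) = w := by
  rw [List.map_map]
  conv_rhs => rw [← List.map_id w]
  exact List.map_congr_left fun s _ => Step.flipAt_flipAt j s

section Expectation

variable [Fintype A] [TopologicalSpace G] [IsTopologicalGroup G] [CompactSpace G] [MeasurableSpace G]
  [BorelSpace G] (ρ : G →* Matrix (Fin N) (Fin N) ℂ)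

/-- **Loop variables of the reversed presentation are flipped-word loop variables**:
`E_{e',β}[tr ρ(hol^{e'}_x(w))] = E_{e,β}[tr ρ(hol^{e}_x(w^♭))]` (every real `β`). [folklore] -/
theorem integral_trace_wordHolonomy_revAxis (hρ : Continuous ρ) (e : Fin d → A) (j : Fin d) (β : ℝ)
    (x : A) (w : Word d) :
    ∫ V, (ρ (wordHolonomy (revAxis e j) V x w)).trace ∂(gibbs ρ (revAxis e j) β) =
      ∫ U, (ρ (wordHolonomy e U x (w.map (Step.flipAt j)))).trace ∂(gibbs ρ e β) := by
  have h := integral_comp_revConfig_gibbs_complex ρ hρ e j β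
    (fun V => (ρ (wordHolonomy (revAxis e j) V x w)).trace)
  simp only [wordHolonomy_revConfig] at h
  exact h.symm

/-- Pair variables of the reversed presentation. [folklore] -/
theorem integral_trace_mul_trace_wordHolonomy_revAxis (hρ : Continuous ρ) (e : Fin d → A) (j : Fin d)
    (β : ℝ) (x : A) (u v : Word d) :
    ∫ V, (ρ (wordHolonomy (revAxis e j) V x u)).trace * (ρ (wordHolonomy (revAxis e j) V x v)).trace
        ∂(gibbs ρ (revAxis e j) β) =
      ∫ U, (ρ (wordHolonomy e U x (u.map (Step.flipAt j)))).trace *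
        (ρ (wordHolonomy e U x (v.map (Step.flipAt j)))).trace ∂(gibbs ρ e β) := by
  have h := integral_comp_revConfig_gibbs_complex ρ hρ e j β
    (fun V => (ρ (wordHolonomy (revAxis e j) V x u)).trace * (ρ (wordHolonomy (revAxis e j) V x v)).trace)
  simp only [wordHolonomy_revConfig] at h
  exact h.symm

end Expectation

/-! ### Half observables built from words -/

/-- **A function of the holonomy of a word all of whose links are half links is a half observable.**
[folklore] -/
theorem isHalfObservable_wordFn {α : Type*} (e : Fin d → A) {P : ℕ} (v : A →+ ZMod (2 * P))
    (x : A) (w : Word d) (f : G → α)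
    (hw : ∀ k (hk : k < w.length), IsHalfLink e P v ((w.get ⟨k, hk⟩).link e (Word.siteAt e x w k))) :
    IsHalfObservable e P v fun U : Config A d G => f (wordHolonomy e U x w) := by
  intro U V hUV
  show f (wordHolonomy e U x w) = f (wordHolonomy e V x w)
  rw [wordHolonomy_congr e x w fun k hk => hUV _ (hw k hk)]

end TiltedRP

end Summit.QuantumFields.GaugeBoot

end
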